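import Summits.HubbardSuperconductivity.HubbardSuperconductivity.Theorems.ThermalWedgeTwSeededEnsembleEquivalenceSectorWeightBasics

/-!
# Crux `TwSeededEnsembleEquivalence` (stmt-HubbardSuperconductivity-1698), thermal line — the secant
# bracket of the seeded pressure from DIFFERENTIABILITY OF ITS INFINITE-VOLUME LIMIT

Support file (`--supports stmt-HubbardSuperconductivity-1698`; no definition, nothing assumed).
The thermal member of line `exposed-density-duality` (skeleton v12, namespace `…ThermalDuality`) closes the
crux from a two-sided SECANT BRACKET of the finite-volume seeded pressure `p_L(β,μ) = log Re Z(β, K_L(μ))/(βL²)`,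
`K_L(μ) = hubbardTorusWith 2 L 1 U μ − (g/L²)P_L`, at an `L`-independent `μ₀` (hypothesis `hBr` of
`stub_thermalCloser`), obtained there from the physics stub `stub_thermalSourcedSecantBracket` through the AHM
transfer `stub_ahmTransfer`. This file records the ENGINE-FACING normal form of that input: `hBr` holds at some
`μ₀` of the window as soon as
* (TDL) `p_L(β, μ) → b(μ)` pointwise on `[μ₁, μ₂]` (thermodynamic limit of the seeded pressure; by the landed
  approximating-Hamiltonian theorem, item 1703, `b = lim_L ⨆_h [p̃_L(β,μ,h) − h²/g]` as well);
* (DIFF) `b` is differentiable on `(μ₁, μ₂)` — NO KINK of the infinite-volume seeded pressure, i.e. no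
  first-order jump of the seeded grand-canonical density across the window at inverse temperature `β`;
* (EDGE) two interior points with `b′(μ⁻) ≤ 1 − δ ≤ b′(μ⁺)` (or two edge SECANTS of `b` bracketing `1 − δ`, using
  convexity: `tw_seededSecantBracket_of_differentiableLimit_secant` in the companion `…OfSourcedLimit.lean`).
Proof: `μ ↦ log Re Z(β, K_L(μ))` is convex (sector decomposition + `μ`-tilt of the landed
`stub_sectorWeightBasics`: `Re Z(μ) = Σ_N W_L(N; 0) e^{βμN}`, a log-sum-exp; Hölder), hence so is `b`; Darboux
(`Convex.image_deriv`) gives `μ₀ ∈ [μ⁻, μ⁺]` with `b′(μ₀) = 1 − δ`; the KINK LEMMA (pointwise convergence at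
`μ₀, μ₀ ± τ` + `HasDerivAt b (1−δ) μ₀`) pins both finite-volume secants within `η`, eventually in `L`. So, modulo
the line's bookkeeping stubs A–E, the restated crux (`hEns` of `twSeededRung_structural_thermalWindow`) follows
from "(TDL) + (DIFF) + (EDGE) on the thermal window `1 ≤ β ≤ e^{a/U}`, `g ≥ K'U`" — the analogue, one
`μ`-derivative deep, of the zero-source cumulant bound `(K)` that normalises crux 1696. Bratteli–Robinson II §5.3.1 (convexity
of `log Tr e^{−β(H−μN)}`); Ruelle (1969) §3.4; Griffiths (1964) (limits of convex functions). [folklore]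
-/

set_option linter.dupNamespace false

namespace Summit.HubbardSuperconductivity.HubbardSuperconductivity.Theorems.TwSeededEnsembleEquivalence.ThermalDuality

open Matrix Filter Topology Finset Literature.MathematicalPhysics.QuantumLattice
open scoped ComplexOrder Matrix.Norms.L2Operator

noncomputable section

/-! ### §1 Model-free real analysis -/

/-- **Log-sum-exp is convex**: for positive weights `wᵢ` and real rates `cᵢ` on a nonempty finite set,
`x ↦ log Σᵢ wᵢ e^{cᵢ x}` is convex on `ℝ` (Hölder with exponents `1/a, 1/b`). [folklore] -/
theorem bdl_convexOn_log_sum_mul_exp {ι : Type*} (s : Finset ι) (hs : s.Nonempty) (w c : ι → ℝ)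
    (hw : ∀ i ∈ s, 0 < w i) :
    ConvexOn ℝ Set.univ (fun x : ℝ => Real.log (∑ i ∈ s, w i * Real.exp (c i * x))) := by
  refine ⟨convex_univ, ?_⟩
  intro x _ y _ a b ha hb hab
  have hZpos : ∀ z : ℝ, 0 < ∑ i ∈ s, w i * Real.exp (c i * z) := fun z =>
    Finset.sum_pos (fun i hi => mul_pos (hw i hi) (Real.exp_pos _)) hs
  simp only [smul_eq_mul]
  rcases ha.eq_or_lt with h0 | ha'
  · subst h0
    simp only [zero_add] at hab
    subst hab
    simp
  rcases hb.eq_or_lt with h0 | hb'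
  · subst h0
    simp only [add_zero] at hab
    subst hab
    simp
  have hpq : a⁻¹.HolderConjugate b⁻¹ := Real.HolderConjugate.inv_inv ha' hb' hab
  set F : ι → ℝ := fun i => (w i * Real.exp (c i * x)) ^ a with hF
  set G : ι → ℝ := fun i => (w i * Real.exp (c i * y)) ^ b with hG
  have hFnn : ∀ i ∈ s, 0 ≤ F i := fun i hi =>
    Real.rpow_nonneg (mul_pos (hw i hi) (Real.exp_pos _)).le _
  have hGnn : ∀ i ∈ s, 0 ≤ G i := fun i hi =>
    Real.rpow_nonneg (mul_pos (hw i hi) (Real.exp_pos _)).le _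
  have hH := Real.inner_le_Lp_mul_Lq_of_nonneg s hpq hFnn hGnn
  have hFG : ∀ i ∈ s, F i * G i = w i * Real.exp (c i * (a * x + b * y)) := by
    intro i hi
    have hwi := hw i hi
    have hww : w i ^ a * w i ^ b = w i := by
      rw [← Real.rpow_add hwi, hab, Real.rpow_one]
    simp only [hF, hG]
    rw [Real.mul_rpow hwi.le (Real.exp_pos _).le, Real.mul_rpow hwi.le (Real.exp_pos _).le,
      ← Real.exp_mul, ← Real.exp_mul]
    calc w i ^ a * Real.exp (c i * x * a) * (w i ^ b * Real.exp (c i * y * b))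
        = (w i ^ a * w i ^ b) * (Real.exp (c i * x * a) * Real.exp (c i * y * b)) := by ring
      _ = w i * Real.exp (c i * (a * x + b * y)) := by
          rw [hww, ← Real.exp_add]
          congr 1
          ring
  have hFp : ∀ i ∈ s, F i ^ a⁻¹ = w i * Real.exp (c i * x) := fun i hi =>
    Real.rpow_rpow_inv (mul_pos (hw i hi) (Real.exp_pos _)).le ha'.ne'
  have hGq : ∀ i ∈ s, G i ^ b⁻¹ = w i * Real.exp (c i * y) := fun i hi =>
    Real.rpow_rpow_inv (mul_pos (hw i hi) (Real.exp_pos _)).le hb'.ne'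
  rw [Finset.sum_congr rfl hFG, Finset.sum_congr rfl hFp, Finset.sum_congr rfl hGq,
    one_div, one_div, inv_inv, inv_inv] at hH
  have hx0 := hZpos x
  have hy0 := hZpos y
  calc Real.log (∑ i ∈ s, w i * Real.exp (c i * (a * x + b * y)))
      ≤ Real.log ((∑ i ∈ s, w i * Real.exp (c i * x)) ^ a *
          (∑ i ∈ s, w i * Real.exp (c i * y)) ^ b) :=
        Real.log_le_log (hZpos _) hH
    _ = a * Real.log (∑ i ∈ s, w i * Real.exp (c i * x)) +
          b * Real.log (∑ i ∈ s, w i * Real.exp (c i * y)) := by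
        rw [Real.log_mul (Real.rpow_pos_of_pos hx0 _).ne' (Real.rpow_pos_of_pos hy0 _).ne',
          Real.log_rpow hx0, Real.log_rpow hy0]

/-- **Kink lemma** (public form of the line's private `kink_lemma`): pointwise convergence
`f_L(μ) → b(μ)` on `[μ₀ − r, μ₀ + r]` and `HasDerivAt b d μ₀` pin both one-sided secants of `f_L` at
`μ₀` over some step `τ ∈ (0, r]` to within `η` of `d`, eventually in `L`. [folklore] -/
theorem bdl_secantBracket_of_hasDerivAt (f : ℕ → ℝ → ℝ) (b : ℝ → ℝ) (μ₀ d r : ℝ) (hr : 0 < r)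
    (hlim : ∀ μ ∈ Set.Icc (μ₀ - r) (μ₀ + r), ∀ κ : ℝ, 0 < κ → ∃ L₀ : ℕ, ∀ L, L₀ ≤ L →
      |f L μ - b μ| ≤ κ)
    (hd : HasDerivAt b d μ₀) :
    ∀ η : ℝ, 0 < η → ∃ τ : ℝ, 0 < τ ∧ τ ≤ r ∧ ∃ L₀ : ℕ, ∀ L, L₀ ≤ L →
      |(f L (μ₀ + τ) - f L μ₀) / τ - d| ≤ η ∧ |(f L μ₀ - f L (μ₀ - τ)) / τ - d| ≤ η := by
  intro η hη
  have hslope := hd.tendsto_slope_zero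
  rw [Metric.tendsto_nhdsWithin_nhds] at hslope
  obtain ⟨δ, hδ, hδ'⟩ := hslope (η / 2) (by linarith)
  set τ : ℝ := min (δ / 2) r with hτ
  have hτpos : 0 < τ := lt_min (by linarith) hr
  have hτr : τ ≤ r := min_le_right _ _
  have hτδ : τ < δ := lt_of_le_of_lt (min_le_left _ _) (by linarith)
  -- the two limiting secants
  have hplus : |(b (μ₀ + τ) - b μ₀) / τ - d| < η / 2 := by
    have h := @hδ' τ (by simp [hτpos.ne']) (by rw [dist_zero_right, Real.norm_eq_abs, abs_of_pos hτpos]; exact hτδ)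
    rw [Real.dist_eq, smul_eq_mul] at h
    rwa [div_eq_inv_mul]
  have hminus : |(b μ₀ - b (μ₀ - τ)) / τ - d| < η / 2 := by
    have h := @hδ' (-τ) (by simp [hτpos.ne']) (by
      rw [dist_zero_right, Real.norm_eq_abs, abs_neg, abs_of_pos hτpos]; exact hτδ)
    rw [Real.dist_eq, smul_eq_mul] at h
    have e : (-τ)⁻¹ * (b (μ₀ + -τ) - b μ₀) = (b μ₀ - b (μ₀ - τ)) / τ := by
      rw [← sub_eq_add_neg, inv_neg, div_eq_inv_mul]
      ring
    rwa [e] at h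
  -- finite-volume corrections at the three points
  have hκ : 0 < η * τ / 4 := by positivity
  have hmem0 : μ₀ ∈ Set.Icc (μ₀ - r) (μ₀ + r) := ⟨by linarith, by linarith⟩
  have hmemp : μ₀ + τ ∈ Set.Icc (μ₀ - r) (μ₀ + r) := ⟨by linarith, by linarith⟩
  have hmemm : μ₀ - τ ∈ Set.Icc (μ₀ - r) (μ₀ + r) := ⟨by linarith, by linarith⟩
  obtain ⟨L₁, h1⟩ := hlim _ hmem0 _ hκ
  obtain ⟨L₂, h2⟩ := hlim _ hmemp _ hκ
  obtain ⟨L₃, h3⟩ := hlim _ hmemm _ hκ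
  refine ⟨τ, hτpos, hτr, max L₁ (max L₂ L₃), fun L hL => ?_⟩
  have e1 := h1 L ((le_max_left _ _).trans hL)
  have e2 := h2 L (((le_max_left _ _).trans (le_max_right _ _)).trans hL)
  have e3 := h3 L (((le_max_right _ _).trans (le_max_right _ _)).trans hL)
  rw [abs_le] at e1 e2 e3 ⊢
  rw [abs_lt] at hplus hminus
  rw [abs_le]
  have hτne : τ ≠ 0 := hτpos.ne'
  constructor
  · -- right secant
    have key : (f L (μ₀ + τ) - f L μ₀) / τ - d =
        ((b (μ₀ + τ) - b μ₀) / τ - d) + ((f L (μ₀ + τ) - b (μ₀ + τ)) - (f L μ₀ - b μ₀)) / τ := by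
      field_simp
      ring
    rw [key]
    have hb1 : ((f L (μ₀ + τ) - b (μ₀ + τ)) - (f L μ₀ - b μ₀)) / τ ≤ η / 2 := by
      rw [div_le_iff₀ hτpos]; nlinarith [e2.2, e1.1]
    have hb2 : -(η / 2) ≤ ((f L (μ₀ + τ) - b (μ₀ + τ)) - (f L μ₀ - b μ₀)) / τ := by
      rw [le_div_iff₀ hτpos]; nlinarith [e2.1, e1.2]
    constructor <;> linarith [hplus.1, hplus.2]
  · -- left secant
    have key : (f L μ₀ - f L (μ₀ - τ)) / τ - d =
        ((b μ₀ - b (μ₀ - τ)) / τ - d) + ((f L μ₀ - b μ₀) - (f L (μ₀ - τ) - b (μ₀ - τ))) / τ := by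
      field_simp
      ring
    rw [key]
    have hb1 : ((f L μ₀ - b μ₀) - (f L (μ₀ - τ) - b (μ₀ - τ))) / τ ≤ η / 2 := by
      rw [div_le_iff₀ hτpos]; nlinarith [e1.2, e3.1]
    have hb2 : -(η / 2) ≤ ((f L μ₀ - b μ₀) - (f L (μ₀ - τ) - b (μ₀ - τ))) / τ := by
      rw [le_div_iff₀ hτpos]; nlinarith [e1.1, e3.2]
    constructor <;> linarith [hminus.1, hminus.2]

/-- **Secant bracket from a differentiable limit** (model-free). If `f_L → b` pointwise on `[μ₁, μ₂]`,
`b` is differentiable on `(μ₁, μ₂)` and `b′(μ⁻) ≤ d ≤ b′(μ⁺)` at two interior points, then (Darboux)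
`b′(μ₀) = d` at some `μ₀` between `μ⁻` and `μ⁺`, and (kink lemma) for every `η > 0` some step `τ > 0`
has both one-sided secants of `f_L` at `μ₀` within `η` of `d`, eventually in `L`. [folklore] -/
theorem bdl_bracket_of_differentiableLimit (f : ℕ → ℝ → ℝ) (b : ℝ → ℝ) (μ₁ μ₂ d μm μp : ℝ)
    (hlim : ∀ μ ∈ Set.Icc μ₁ μ₂, ∀ κ : ℝ, 0 < κ → ∃ L₀ : ℕ, ∀ L, L₀ ≤ L → |f L μ - b μ| ≤ κ)
    (hdiff : ∀ μ ∈ Set.Ioo μ₁ μ₂, DifferentiableAt ℝ b μ)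
    (hm : μm ∈ Set.Ioo μ₁ μ₂) (hp : μp ∈ Set.Ioo μ₁ μ₂)
    (hdm : deriv b μm ≤ d) (hdp : d ≤ deriv b μp) :
    ∃ μ₀ ∈ Set.uIcc μm μp, μ₀ ∈ Set.Ioo μ₁ μ₂ ∧ HasDerivAt b d μ₀ ∧
      ∀ η : ℝ, 0 < η → ∃ τ : ℝ, 0 < τ ∧ ∃ L₀ : ℕ, ∀ L, L₀ ≤ L →
        (f L (μ₀ + τ) - f L μ₀) / τ ≤ d + η ∧ d - η ≤ (f L μ₀ - f L (μ₀ - τ)) / τ := by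
  have hsub : Set.uIcc μm μp ⊆ Set.Ioo μ₁ μ₂ := Set.ordConnected_Ioo.uIcc_subset hm hp
  have himg : Convex ℝ (deriv b '' Set.uIcc μm μp) :=
    (convex_uIcc μm μp).image_deriv fun x hx => hdiff x (hsub hx)
  have hd : d ∈ deriv b '' Set.uIcc μm μp :=
    himg.ordConnected.out (Set.mem_image_of_mem _ Set.left_mem_uIcc)
      (Set.mem_image_of_mem _ Set.right_mem_uIcc) ⟨hdm, hdp⟩
  obtain ⟨μ₀, hμ₀, hμ₀d⟩ := hd
  have hμ₀I : μ₀ ∈ Set.Ioo μ₁ μ₂ := hsub hμ₀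
  have hder : HasDerivAt b d μ₀ := hμ₀d ▸ (hdiff μ₀ hμ₀I).hasDerivAt
  refine ⟨μ₀, hμ₀, hμ₀I, hder, fun η hη => ?_⟩
  set r : ℝ := min (μ₀ - μ₁) (μ₂ - μ₀) with hr
  have hrpos : 0 < r := lt_min (by linarith [hμ₀I.1]) (by linarith [hμ₀I.2])
  have hr1 : r ≤ μ₀ - μ₁ := min_le_left _ _
  have hr2 : r ≤ μ₂ - μ₀ := min_le_right _ _
  have hlim' : ∀ μ ∈ Set.Icc (μ₀ - r) (μ₀ + r), ∀ κ : ℝ, 0 < κ → ∃ L₀ : ℕ, ∀ L, L₀ ≤ L →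
      |f L μ - b μ| ≤ κ := fun μ hμ => hlim μ ⟨by linarith [hμ.1], by linarith [hμ.2]⟩
  obtain ⟨τ, hτ, -, L₀, hL₀⟩ := bdl_secantBracket_of_hasDerivAt f b μ₀ d r hrpos hlim' hder η hη
  refine ⟨τ, hτ, L₀, fun L hL => ?_⟩
  obtain ⟨h1, h2⟩ := hL₀ L hL
  rw [abs_le] at h1 h2
  exact ⟨by linarith [h1.2], by linarith [h2.1]⟩

/-! ### §2 The seeded torus pressure -/

/-- **Convexity of `μ ↦ log Re Z(β, K_L(μ))`** for the seeded grand-canonical torus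
`K_L(μ) = hubbardTorusWith 2 L 1 U μ − (g/L²)P_L`, `β > 0`: by the sector decomposition and the
`μ`-tilt of `stub_sectorWeightBasics`, `Re Z(μ) = Σ_{N ≤ 2L²} W_L(N; β, 0) e^{βμN}` with positive sector
weights, a log-sum-exp. Bratteli–Robinson II §5.3.1. [folklore] -/
theorem bdl_convexOn_log_seededPartitionFn (L : ℕ) [NeZero L] (U g β : ℝ) (hβ : 0 < β) :
    ConvexOn ℝ Set.univ (fun μ : ℝ =>
      Real.log (Matrix.partitionFn β (hubbardTorusWith 2 L 1 U μ - ((g / (L : ℝ) ^ 2 : ℝ) : ℂ) •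
        ((pairField dWaveFormFactor L)ᴴ * pairField dWaveFormFactor L))).re) := by
  obtain ⟨hZ, htilt, hpos, -⟩ := stub_sectorWeightBasics L U g β hβ
  have hfun : (fun μ : ℝ =>
      Real.log (Matrix.partitionFn β (hubbardTorusWith 2 L 1 U μ - ((g / (L : ℝ) ^ 2 : ℝ) : ℂ) •
        ((pairField dWaveFormFactor L)ᴴ * pairField dWaveFormFactor L))).re) =
      fun μ : ℝ => Real.log (∑ N ∈ Finset.range (2 * L ^ 2 + 1),
        (∑ s ∈ (Finset.univ.filter fun s : Finset (Orb (FermionTorus 2 L)) => s.card = N),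
          (Matrix.gibbsWeight β (hubbardTorusWith 2 L 1 U 0 - ((g / (L : ℝ) ^ 2 : ℝ) : ℂ) •
            ((pairField dWaveFormFactor L)ᴴ * pairField dWaveFormFactor L)) s s).re) *
          Real.exp ((β * N) * μ)) := by
    funext μ
    rw [hZ μ]
    congr 1
    refine Finset.sum_congr rfl fun N _ => ?_
    rw [htilt 0 μ N, mul_comm]
    congr 1
    congr 1
    ring
  rw [hfun]
  refine bdl_convexOn_log_sum_mul_exp (Finset.range (2 * L ^ 2 + 1)) ⟨0, by simp⟩ _ _ ?_
  intro N hN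
  exact hpos 0 N (by simpa [Nat.lt_succ_iff] using hN)

/-- **Convexity of the seeded pressure** `μ ↦ p_L(β, μ) = log Re Z(β, K_L(μ))/(βL²)` (`β > 0`), on any
convex set of chemical potentials. [folklore] -/
theorem bdl_convexOn_seededPressure (L : ℕ) [NeZero L] (U g β : ℝ) (hβ : 0 < β) {S : Set ℝ}
    (hS : Convex ℝ S) :
    ConvexOn ℝ S (fun μ : ℝ =>
      Real.log (Matrix.partitionFn β (hubbardTorusWith 2 L 1 U μ - ((g / (L : ℝ) ^ 2 : ℝ) : ℂ) •
        ((pairField dWaveFormFactor L)ᴴ * pairField dWaveFormFactor L))).re / (β * (L : ℝ) ^ 2)) := by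
  have h := bdl_convexOn_log_seededPartitionFn L U g β hβ
  refine ⟨hS, fun x _ y _ a b ha hb hab => ?_⟩
  have := h.2 (Set.mem_univ x) (Set.mem_univ y) ha hb hab
  simp only [smul_eq_mul] at this ⊢
  have hc : 0 ≤ β * (L : ℝ) ^ 2 := by positivity
  calc _ ≤ (a * Real.log (Matrix.partitionFn β (hubbardTorusWith 2 L 1 U x -
            ((g / (L : ℝ) ^ 2 : ℝ) : ℂ) • ((pairField dWaveFormFactor L)ᴴ * pairField dWaveFormFactor L))).re +
          b * Real.log (Matrix.partitionFn β (hubbardTorusWith 2 L 1 U y -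
            ((g / (L : ℝ) ^ 2 : ℝ) : ℂ) • ((pairField dWaveFormFactor L)ᴴ * pairField dWaveFormFactor L))).re) /
          (β * (L : ℝ) ^ 2) := div_le_div_of_nonneg_right this hc
    _ = _ := by ring

/-- **THERMAL SECANT BRACKET OF THE SEEDED PRESSURE FROM A DIFFERENTIABLE INFINITE-VOLUME LIMIT.**
Fix `δ, U, g, β`, a window `μ₁ < μ₂` and `b : ℝ → ℝ`. If (TDL) the finite-volume seeded pressure
`p_L(β, μ)` converges to `b(μ)` for every `μ ∈ [μ₁, μ₂]`, (DIFF) `b` is differentiable on `(μ₁, μ₂)`, and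
(EDGE) `b′(μ⁻) ≤ 1 − δ ≤ b′(μ⁺)` at two interior points, then there is an `L`-INDEPENDENT `μ₀ ∈ [μ₁, μ₂]`
(between `μ⁻` and `μ⁺`, with `b′(μ₀) = 1 − δ`) at which the two-sided secant bracket of `p_L(β, ·)` holds:
for every `η > 0` some step `τ > 0` has `(p_L(μ₀+τ) − p_L(μ₀))/τ ≤ (1−δ) + η` and
`(1−δ) − η ≤ (p_L(μ₀) − p_L(μ₀−τ))/τ` eventually in `L` — verbatim the hypothesis `hBr` of the line's
closer `stub_thermalCloser`. [folklore] -/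
theorem tw_seededSecantBracket_of_differentiableLimit (δ U g β μ₁ μ₂ μm μp : ℝ) (b : ℝ → ℝ)
    (hlim : ∀ μ ∈ Set.Icc μ₁ μ₂, ∀ κ : ℝ, 0 < κ → ∃ L₀ : ℕ, ∀ (L : ℕ) [NeZero L], L₀ ≤ L →
      |Real.log (Matrix.partitionFn β (hubbardTorusWith 2 L 1 U μ - ((g / (L : ℝ) ^ 2 : ℝ) : ℂ) •
          ((pairField dWaveFormFactor L)ᴴ * pairField dWaveFormFactor L))).re / (β * (L : ℝ) ^ 2) -
        b μ| ≤ κ)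
    (hdiff : ∀ μ ∈ Set.Ioo μ₁ μ₂, DifferentiableAt ℝ b μ)
    (hm : μm ∈ Set.Ioo μ₁ μ₂) (hp : μp ∈ Set.Ioo μ₁ μ₂)
    (hdm : deriv b μm ≤ 1 - δ) (hdp : 1 - δ ≤ deriv b μp) :
    ∃ μ₀ ∈ Set.Icc μ₁ μ₂, μ₀ ∈ Set.uIcc μm μp ∧ HasDerivAt b (1 - δ) μ₀ ∧
      ∀ η : ℝ, 0 < η → ∃ τ : ℝ, 0 < τ ∧ ∃ L₀ : ℕ, ∀ (L : ℕ) [NeZero L], L₀ ≤ L →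
        ((Real.log (Matrix.partitionFn β (hubbardTorusWith 2 L 1 U (μ₀ + τ) - ((g / (L : ℝ) ^ 2 : ℝ) : ℂ) •
            ((pairField dWaveFormFactor L)ᴴ * pairField dWaveFormFactor L))).re / (β * (L : ℝ) ^ 2)) -
          (Real.log (Matrix.partitionFn β (hubbardTorusWith 2 L 1 U μ₀ - ((g / (L : ℝ) ^ 2 : ℝ) : ℂ) •
            ((pairField dWaveFormFactor L)ᴴ * pairField dWaveFormFactor L))).re / (β * (L : ℝ) ^ 2))) / τ ≤
          (1 - δ) + η ∧
        (1 - δ) - η ≤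
        ((Real.log (Matrix.partitionFn β (hubbardTorusWith 2 L 1 U μ₀ - ((g / (L : ℝ) ^ 2 : ℝ) : ℂ) •
            ((pairField dWaveFormFactor L)ᴴ * pairField dWaveFormFactor L))).re / (β * (L : ℝ) ^ 2)) -
          (Real.log (Matrix.partitionFn β (hubbardTorusWith 2 L 1 U (μ₀ - τ) - ((g / (L : ℝ) ^ 2 : ℝ) : ℂ) •
            ((pairField dWaveFormFactor L)ᴴ * pairField dWaveFormFactor L))).re / (β * (L : ℝ) ^ 2))) / τ := by
  -- the pressures as a plain sequence of functions, re-indexed by `L ↦ L + 1`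
  set f : ℕ → ℝ → ℝ := fun L μ =>
    Real.log (Matrix.partitionFn β (hubbardTorusWith 2 (L + 1) 1 U μ - ((g / ((L + 1 : ℕ) : ℝ) ^ 2 : ℝ) : ℂ) •
      ((pairField dWaveFormFactor (L + 1))ᴴ * pairField dWaveFormFactor (L + 1)))).re /
        (β * ((L + 1 : ℕ) : ℝ) ^ 2) with hf
  have hlim' : ∀ μ ∈ Set.Icc μ₁ μ₂, ∀ κ : ℝ, 0 < κ → ∃ L₀ : ℕ, ∀ L, L₀ ≤ L → |f L μ - b μ| ≤ κ := by
    intro μ hμ κ hκ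
    obtain ⟨L₀, hL₀⟩ := hlim μ hμ κ hκ
    exact ⟨L₀, fun L hL => hL₀ (L + 1) (by omega)⟩
  obtain ⟨μ₀, hμ₀, hμ₀I, hder, hbr⟩ :=
    bdl_bracket_of_differentiableLimit f b μ₁ μ₂ (1 - δ) μm μp hlim' hdiff hm hp hdm hdp
  refine ⟨μ₀, ⟨hμ₀I.1.le, hμ₀I.2.le⟩, hμ₀, hder, fun η hη => ?_⟩
  obtain ⟨τ, hτ, L₀, hL₀⟩ := hbr η hη
  refine ⟨τ, hτ, L₀ + 1, fun L _ hL => ?_⟩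
  obtain ⟨k, rfl⟩ := Nat.exists_eq_add_one_of_ne_zero (NeZero.ne L)
  exact hL₀ k (by omega)


/-- **Registered bridge stub** (binder-free form of `tw_seededSecantBracket_of_differentiableLimit`, the shape
recorded on the item by `stub-add`): (TDL) + (DIFF) + (EDGE) for the infinite-volume seeded pressure ⟹ the
two-sided secant bracket `hBr` of the finite-volume seeded pressure at an `L`-independent `μ₀`. [folklore] -/
theorem stub_thermalBracket_of_differentiableLimit :
    ∀ (δ U g β μ₁ μ₂ μm μp : ℝ) (b : ℝ → ℝ), (∀ μ ∈ Set.Icc μ₁ μ₂, ∀ κ : ℝ, 0 < κ → ∃ L₀ : ℕ, ∀ (L : ℕ) [NeZero L], L₀ ≤ L → |Real.log (Matrix.partitionFn β (Literature.MathematicalPhysics.QuantumLattice.hubbardTorusWith 2 L 1 U μ - ((g / (L : ℝ) ^ 2 : ℝ) : ℂ) • ((Literature.MathematicalPhysics.QuantumLattice.pairField Literature.MathematicalPhysics.QuantumLattice.dWaveFormFactor L)ᴴ * Literature.MathematicalPhysics.QuantumLattice.pairField Literature.MathematicalPhysics.QuantumLattice.dWaveFormFactor L))).re / (β * (L : ℝ)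 ^ 2) - b μ| ≤ κ) → (∀ μ ∈ Set.Ioo μ₁ μ₂, DifferentiableAt ℝ b μ) → μm ∈ Set.Ioo μ₁ μ₂ → μp ∈ Set.Ioo μ₁ μ₂ → deriv b μm ≤ 1 - δ → 1 - δ ≤ deriv b μp → ∃ μ₀ ∈ Set.Icc μ₁ μ₂, μ₀ ∈ Set.uIcc μm μp ∧ HasDerivAt b (1 - δ) μ₀ ∧ ∀ η : ℝ, 0 < η → ∃ τ : ℝ, 0 < τ ∧ ∃ L₀ : ℕ, ∀ (L : ℕ) [NeZero L], L₀ ≤ L → ((Real.log (Matrix.partitionFn β (Literature.MathematicalPhysics.QuantumLattice.hubbardTorusWith 2 L 1 U (μ₀ + τ) - ((g / (L : ℝ) ^ 2 : ℝ) : ℂ) • ((Literature.MathematicalPhysics.QuantumLattice.pairField Literature.MathematicalPhysics.QuantumLattice.dWaveFormFactor L)ᴴ * Literature.MathematicalPhysics.QuantumLattice.pairField Literature.MathematicalPhysics.QuantumLattice.dWaveFormFactor L))).re / (β * (L : ℝ) ^ 2)) - (Real.log (Matrix.partitionFn β (Literature.MathematicalPhysics.QuantumLattice.hubbardTorusWith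 2 L 1 U μ₀ - ((g / (L : ℝ) ^ 2 : ℝ) : ℂ) • ((Literature.MathematicalPhysics.QuantumLattice.pairField Literature.MathematicalPhysics.QuantumLattice.dWaveFormFactor L)ᴴ * Literature.MathematicalPhysics.QuantumLattice.pairField Literature.MathematicalPhysics.QuantumLattice.dWaveFormFactor L))).re / (β * (L : ℝ) ^ 2))) / τ ≤ (1 - δ) + η ∧ (1 - δ) - η ≤ ((Real.log (Matrix.partitionFn β (Literature.MathematicalPhysics.QuantumLattice.hubbardTorusWith 2 L 1 U μ₀ - ((g / (L : ℝ) ^ 2 : ℝ) : ℂ) • ((Literature.MathematicalPhysics.QuantumLattice.pairField Literature.MathematicalPhysics.QuantumLattice.dWaveFormFactor L)ᴴ * Literature.MathematicalPhysics.QuantumLattice.pairField Literature.MathematicalPhysics.QuantumLattice.dWaveFormFactor L))).re / (β * (L : ℝ) ^ 2)) - (Real.log (Matrix.partitionFn β (Literature.MathematicalPhysics.QuantumLattice.hubbardTorusWith 2 L 1 U (μ₀ - τ) - ((g / (L : ℝ) ^ 2 : ℝ) : ℂ) • ((Literature.MathematicalPhysics.QuantumLattice.pairField Literature.MathematicalPhysics.QuantumLattice.dWaveFormFactor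 L)ᴴ * Literature.MathematicalPhysics.QuantumLattice.pairField Literature.MathematicalPhysics.QuantumLattice.dWaveFormFactor L))).re / (β * (L : ℝ) ^ 2))) / τ := by
  intro δ U g β μ₁ μ₂ μm μp b hlim hdiff hm hp hdm hdp
  exact tw_seededSecantBracket_of_differentiableLimit δ U g β μ₁ μ₂ μm μp b hlim hdiff hm hp hdm hdp

end

end Summit.HubbardSuperconductivity.HubbardSuperconductivity.Theorems.TwSeededEnsembleEquivalence.ThermalDuality
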